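/-
Copyright (c) 2026. All rights reserved.
Released under Apache 2.0 license as described in the file LICENSE.
Authors: abc-iut cell, seat abc-iut-f-069 (gen 3; Prop 1.3 (ii) "`I_e ≅ Ẑ^Σ × Ẑ^Σ`" at constructed data).
-/
import Literature.AnabelianGeometry.AbsoluteAnabelian.AbsTopII.DPSCInertiaOfOuterActionZhat
import Literature.AnabelianGeometry.AbsoluteAnabelian.AbsTopII.DPSCDataOfOuterActionNodeExact
import Literature.AnabelianGeometry.AbsoluteAnabelian.AbsTopII.DPSCIndexDataOfEmbeddingCuspCyclic

/-!
# [AbsTopII] Prop 1.3 (ii), "as abstract profinite groups, `I_e ≅ Ẑ^Σ × Ẑ^Σ`", at `Π_𝒢 ⋊^out_θ J`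

S. Mochizuki, *Topics in Absolute Anabelian Geometry II* [AbsTopII] (bib `MochizukiAbsTopII2013`; kurims
manuscript `paper:url-585b8d0ad0d9`), §1 Def 1.2 (ii) p. 10, Prop 1.3 (ii) p. 11: "Suppose that `e` is a node
… as abstract profinite groups, `I_e ≅ Ẑ^Σ × Ẑ^Σ`" (proof pp. 12–13: `I_e = Im(Π^Σ_ν)`, the maximal pro-`Σ`
quotient of the log fundamental group of the log point `ν`); [CombGC] (bib `MochizukiCombGC2007`) Def 1.1 (ii),
Rmk 1.1.3, Prop 1.2 (ii).

PROOF-ONLY (no definition).  The SECOND clause of abc-iut-L4-t6's `Prop_1_3_ii` / `Prop_1_3_ii'` as typed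
(`∃ A B ≤ Π_H` closed, free pro-`Σ`-cyclic, with `I_e` their internal direct product) at the constructed
DPSC-extension, from hypotheses on the construction data: node groups `≅ Ẑ^Σ` (Rmk 1.1.3), [CombGC]
Prop 1.2 (ii) (F-0438), slim verticial subgroups, Π_v-fixing lifts of `ρ_I`, `I` closed with `I ≅ Ẑ^Σ`.  The
two factors are EXPLICIT: `A := Π_e` and `B := g·I_v·g⁻¹`, the inertia group of a branch (pro-)vertex of
`e` (`Π_e ⊆ gΠ_vg⁻¹`, L3's `PSCDatum.nodeGp_le`): `B ⊆ I_e` (antitone centraliser, p439117), `I_e = B · Π_e`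
(p437485 `IvNode_eq_conj_Iv_sup_nodeSub`), `B ∩ Π_e ⊆ gI_vg⁻¹ ∩ Π_𝔾 = {1}`, `B` centralises `Π_e`, and
`B ≃ₜ* I_v ≃ₜ* I ≅ Ẑ^Σ` (p443326).  Together with `IvNode_exact_ofOuterAction_of_dehn` (p448370) this leaves,
of (ii)/(ii)′ at constructed data, only the BRANCH-PAIR clause (the finite index `i^Σ_e` of
`I_v × I_{v′} ↪ I_e` — the `Σ`-index datum of Ex 1.1 (iii)).  HONEST FRAMING: classical group theory; typed ≠
proved for the named inputs; nothing here bears on [IUTchIII] Cor 3.12 or takes a side on any author.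
-/

noncomputable section

open scoped Pointwise

namespace Literature.AnabelianGeometry.AbsoluteAnabelian

open Literature.AlgebraicGeometry.Frobenioids (IsSlimGroup)
open Literature.AnabelianGeometry.EtaleTheta (contMulAut mem_contMulAut TopOut)
open Literature.AnabelianGeometry.SemiGraphs
open Topology

universe u

/-! ## §A. Conjugation as an isomorphism of topological groups on a subgroup -/

section GroupTheory

variable {G : Type u} [Group G] [TopologicalSpace G] [IsTopologicalGroup G]

/-- `H ≃ₜ* g·H·g⁻¹` by conjugation. [folklore] -/
private theorem exists_conjContinuousMulEquiv (g : G) (H : Subgroup G) :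
    Nonempty (↥H ≃ₜ* ↥(MulAut.conj g • H : Subgroup G)) := by
  refine ⟨{ toFun := fun x => ⟨g * x * g⁻¹, Subgroup.smul_mem_pointwise_smul _ _ _ x.2⟩
            invFun := fun y => ⟨g⁻¹ * y * g, by
              obtain ⟨h, hh, hy⟩ := (Subgroup.mem_smul_pointwise_iff_exists _ _ _).mp y.2
              have hy' : g * h * g⁻¹ = (y : G) := hy
              rw [← hy']
              convert hh using 1
              group⟩
            left_inv := fun x => Subtype.ext (by group)
            right_inv := fun y => Subtype.ext (by group)
            map_mul' := fun x y => Subtype.ext (by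
              change g * (x * y) * g⁻¹ = g * x * g⁻¹ * (g * y * g⁻¹)
              group)
            continuous_toFun := ?_
            continuous_invFun := ?_ }⟩
  · exact ((continuous_const.mul continuous_subtype_val).mul continuous_const).subtype_mk _
  · exact ((continuous_const.mul continuous_subtype_val).mul continuous_const).subtype_mk _

end GroupTheory

namespace DPSCData

section OuterAction

variable {P : Type u} [Group P] [TopologicalSpace P] [IsTopologicalGroup P] [CompactSpace P]
  [TotallyDisconnectedSpace P] (G : PSCDatum P) (hG : IsTopologicallyFinitelyGenerated P)
  (hZ : Subgroup.center P = ⊥)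
  {J : Type u} [Group J] [TopologicalSpace J] [IsTopologicalGroup J] [CompactSpace J]
  [TotallyDisconnectedSpace J] (θ : J →ₜ* outProfinite hG) (I : Subgroup J) [I.Normal]

include hZ in
/-- **[AbsTopII] Prop 1.3 (ii), "as abstract profinite groups, `I_e ≅ Ẑ^Σ × Ẑ^Σ`", at `Π_𝒢 ⋊^out_θ J`** — the
second clause of `Prop_1_3_ii` / `Prop_1_3_ii'` as typed (two closed free pro-`Σ`-cyclic subgroups of which
`I_e` is the internal direct product), with the EXPLICIT factors `Π_e` and the branch inertia `g·I_v·g⁻¹`,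
from: node groups `≅ Ẑ^Σ` (and abelian), [CombGC] Prop 1.2 (ii), slim verticial subgroups, Π_v-fixing lifts of
`ρ_I`, `I` closed with `I ≅ Ẑ^Σ`. [cite: MochizukiAbsTopII2013, Prop 1.3 (ii) p.11]
[cite: MochizukiCombGC2007, Rmk 1.1.3 p.7] -/
theorem IvNode_isInternalProduct_ofOuterAction_of_dehn
    (hCT : G.VerticialEdgeLikeCommensurablyTerminal) (hslimv : ∀ w, IsSlimGroup ↥(G.vertGp w))
    (hnab : ∀ (e : G.graph.N), ∀ x ∈ G.nodeGp e, ∀ y ∈ G.nodeGp e, x * y = y * x)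
    (hncyc : ∀ e : G.graph.N, AbsTopII.IsFreeProSigmaCyclic G.Sigma ↥(G.nodeGp e))
    (hDehn : ∀ (v : G.graph.V) (i : J), i ∈ I → ∃ φ : P ≃ₜ* P,
      TopOut.mk P ⟨φ.toMulEquiv, (mem_contMulAut P).mpr ⟨φ.continuous, φ.symm.continuous⟩⟩ =
        outerActionOfContinuous hG θ i ∧ ∀ x ∈ G.vertGp v, φ x = x)
    (hIc : IsClosed (I : Set J)) (hI : AbsTopII.IsFreeProSigmaCyclic G.Sigma ↥I)
    (n : (ofOuterAction G hG θ I).Node) :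
    ∃ A B : Subgroup (ofOuterAction G hG θ I).PiH,
      IsClosed (A : Set (ofOuterAction G hG θ I).PiH) ∧ IsClosed (B : Set (ofOuterAction G hG θ I).PiH) ∧
      AbsTopII.IsFreeProSigmaCyclic G.Sigma ↥A ∧ AbsTopII.IsFreeProSigmaCyclic G.Sigma ↥B ∧
      AbsTopII.IsInternalProduct A B ((ofOuterAction G hG θ I).IvNode n) := by
  haveI : (ofOuterAction G hG θ I).PiG.Normal := (ofOuterAction G hG θ I).normal_PiG
  -- Prop 1.3 (iii) first clause and the (ii) exact sequence at the constructed datum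
  have h13 : (ofOuterAction G hG θ I).Prop13iii :=
    prop13iii_ofOuterAction_of_fixing_lifts G hG hZ θ I hCT hslimv hDehn
  obtain ⟨hPe, hEG, -⟩ := IvNode_exact_ofOuterAction_of_dehn G hG hZ θ I hCT hnab hDehn n
  -- a branch vertex `v₁` of `n` and the branch conjugate `g`: `Π_e ⊆ gΠ_{v₁}g⁻¹`
  obtain ⟨v₁, v₂, hends, -, -⟩ := G.nodeGp_le n.down
  have hv : (ofOuterAction G hG θ I).nodeAbuts n ⟨v₁⟩ := by
    change v₁ ∈ G.graph.nodeEnds n.down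
    rw [hends]
    exact Sym2.mem_mk_left _ _
  obtain ⟨g, -, hle⟩ : ∃ g : (ofOuterAction G hG θ I).PiH, g ∈ (ofOuterAction G hG θ I).PiG ∧
      (ofOuterAction G hG θ I).nodeSub n ≤ MulAut.conj g • (ofOuterAction G hG θ I).vertSub ⟨v₁⟩ :=
    nodeSub_le_conj_vertSub_ofEmbedding G _ _ (isClosed_range_inlProfinite hG θ)
    (range_inlProfinite_normal hG θ) (I.comap (sndProfinite hG θ).toMonoidHom) inferInstance
    (range_inl_le_comap_snd hG θ I) n ⟨v₁⟩ hv
  -- `B := gI_{v₁}g⁻¹ ⊆ I_e` and `I_e = B · Π_e`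
  have hIv : MulAut.conj g • (ofOuterAction G hG θ I).Iv ⟨v₁⟩ ≤ (ofOuterAction G hG θ I).IvNode n :=
    (ofOuterAction G hG θ I).conj_Iv_le_IvNode_of_nodeSub_le hle
  have hsum := (ofOuterAction G hG θ I).IvNode_eq_conj_Iv_sup_nodeSub (h13 ⟨v₁⟩).2 hIv hEG
  refine ⟨(ofOuterAction G hG θ I).nodeSub n, MulAut.conj g • (ofOuterAction G hG θ I).Iv ⟨v₁⟩,
    ?_, ?_, ?_, ?_, ⟨hPe, hIv, ?_, ?_, ?_⟩⟩
  · -- `Π_e = inl(Π_{𝒢,e})` is compact, hence closed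
    show IsClosed (((G.nodeGp n.down).map (inlProfinite hG θ).toMonoidHom :
      Subgroup (outerSemidirectProfinite hG θ)) : Set (outerSemidirectProfinite hG θ))
    rw [Subgroup.coe_map]
    exact ((G.isClosed_nodeGp n.down).isCompact.image (inlProfinite hG θ).continuous).isClosed
  · exact isClosed_mulAut_conj_smul (isClosed_Iv_ofOuterAction G hG θ I hIc ⟨v₁⟩) g
  · -- `Π_e ≅ Π_{𝒢,e} ≅ Ẑ^Σ`
    obtain ⟨e, -⟩ := AbsTopII.DPSCIndexData.exists_subgroupEquiv_ofEmbedding (outerSemidirectProfinite hG θ)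
      (inlProfinite hG θ).toMonoidHom (inlProfinite hG θ).continuous (inlProfinite_injective hG θ hZ)
      (G.isClosed_nodeGp n.down)
    exact (hncyc n.down).of_continuousMulEquiv e
  · -- `gI_{v₁}g⁻¹ ≅ I_{v₁} ≅ I ≅ Ẑ^Σ`
    obtain ⟨e⟩ := exists_conjContinuousMulEquiv g ((ofOuterAction G hG θ I).Iv ⟨v₁⟩)
    exact (isFreeProSigmaCyclic_Iv_ofOuterAction G hG θ I hIc h13 hI ⟨v₁⟩).of_continuousMulEquiv e
  · -- `B ⊆ I_e = Z_{Π_I}(Π_e)` commutes with `A = Π_e`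
    intro a ha b hb
    have hbZ := (Subgroup.mem_inf.mp (hIv hb)).1
    exact (Subgroup.mem_centralizer_iff.mp hbZ) a ha
  · -- `A ∩ B ⊆ Π_𝔾 ∩ gI_{v₁}g⁻¹ = g(I_{v₁} ∩ Π_𝔾)g⁻¹ = {1}`
    rw [eq_bot_iff]
    have hBG : MulAut.conj g • (ofOuterAction G hG θ I).Iv ⟨v₁⟩ ⊓ (ofOuterAction G hG θ I).PiG = ⊥ := by
      rw [← Subgroup.Normal.conj_smul_eq_self g (ofOuterAction G hG θ I).PiG, ← Subgroup.smul_inf,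
        (h13 ⟨v₁⟩).1, Subgroup.smul_bot]
    rw [← hBG]
    exact le_inf inf_le_right (le_trans inf_le_left ((ofOuterAction G hG θ I).nodeSub_le n))
  · rw [sup_comm]
    exact hsum.symm

end OuterAction

end DPSCData

end Literature.AnabelianGeometry.AbsoluteAnabelian

end
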